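import Mathlib
import Literature.Computability.AlgebraicComplexity.MatMulTotalComplexity

/-!
# Equation systems for the graph of matrix multiplication — the model (`GraphEquations`, 1/4)

Support module for the decomp-mm node `N5²³` «GraphEquations» (lens 5; route-independent
objects).  Target of the node, VERBATIM: `_root_.MatrixMultiplication` (`omega ℂ = 2`).

**The object.** `W_n ⊆ ℂ^{3n²}`, the GRAPH of `n × n` matrix multiplication
(`mmGraph n = {(A,B,C) | C = AB}`), and *equation systems* for it: a division-free fan-in-two
arithmetic circuit over `ℂ[A,B,C]` (the tree's `ArithCircuit`, total size count = BCS `L^tot` up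
to a factor `3`, exactly the model of `matMulTotalComplexity` / BCS §15.1) together with a list of
gate indices ("tests") such that the common zero set of the test polynomials is exactly `W_n`
(`EqSystem.Correct`).  `EqAdmissible β`: such systems exist at cost `O(n^β)`;
`EqAdmissibleRed β`: the same with systems REDUCED at some point of the graph (the Jacobian of the
tests with respect to the `C`-variables has full rank `n²` there).  This is the NON-ADAPTIVE,
division-free shadow of BCS97 **Problem 16.3** (p. 483: "is the exponent of *verifying* matrix
multiplication equal to the exponent of matrix multiplication?") — deciding membership in `W_n`
versus computing `AB`.

This file: the model only (definitions and their elementary lemmas).  The generator system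
(necessity of the pieces), the cut `S ⟺ V ∧ H` and the cost–rank inequality live in
`GraphEquationsGenerators`, `GraphEquationsKernel`, `GraphEquationsCostRank`.

Design notes.  `n ≥ 1` is imposed in `EqAdmissible`, not in `EqSystem`.  A test index out of
range reads the zero polynomial (a vacuous test); an empty test list has zero set `= univ ≠ W_n`
for `n ≥ 1`, hence is never `Correct`.  Fan-in two is part of `Correct` so that `cost = #gates`
is the honest operation count.  No `instance`, no `notation`.

Sources: [BCS97 = BurgisserClausenShokrollahi1997, Problem 16.3 p.483, Def. (4.2), §15.1 p.375];
[Kunnemann2018 arXiv:1806.09189 p.3, 5: no deterministic `o(n^ω)` verification of `AB = C` known].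
-/

set_option linter.dupNamespace false

noncomputable section

open scoped BigOperators

namespace Summit.MatrixMultiplication.MatrixMultiplication.Theorems.GraphEquations

open Literature.Computability.AlgebraicComplexity
open Literature.Computability.AlgebraicComplexity.ArithCircuit

/-! ## The graph and its coordinates -/

/-- The `3n²` coordinates of `(A, B, C)`: `A ⊕ B = MatMulVars n` (tree) and `C`. -/
abbrev GraphVars (n : ℕ) : Type := MatMulVars n ⊕ (Fin n × Fin n)

/-- The graph `W_n = {(A,B,C) ∈ ℂ^{3n²} | C = AB}` of `n × n` matrix multiplication
(BCS97 Problem 16.3: the set to be DECIDED). -/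
def mmGraph (n : ℕ) : Set (GraphVars n → ℂ) :=
  {x | ∀ i l : Fin n, x (Sum.inr (i, l)) =
      ∑ j : Fin n, x (Sum.inl (Sum.inl (i, j))) * x (Sum.inl (Sum.inr (j, l)))}

/-- `0 ∈ W_n`. -/
theorem zero_mem_mmGraph (n : ℕ) : (0 : GraphVars n → ℂ) ∈ mmGraph n := by
  intro i l; simp

/-- The point `(A, B, AB)` of the graph over a pair `(A, B)` given as `y : MatMulVars n → ℂ`. -/
def graphPoint {n : ℕ} (y : MatMulVars n → ℂ) : GraphVars n → ℂ
  | Sum.inl v => y v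
  | Sum.inr (i, l) => ∑ j : Fin n, y (Sum.inl (i, j)) * y (Sum.inr (j, l))

/-- `(A, B, AB) ∈ W_n`. -/
theorem graphPoint_mem_mmGraph {n : ℕ} (y : MatMulVars n → ℂ) : graphPoint y ∈ mmGraph n := by
  intro i l; simp [graphPoint]

/-- A point of `W_n` is `(A, B, AB)` for its own `(A, B)`-part. -/
theorem graphPoint_eq_of_mem {n : ℕ} {x : GraphVars n → ℂ} (hx : x ∈ mmGraph n) :
    graphPoint (fun v => x (Sum.inl v)) = x := by
  funext v
  rcases v with v | ⟨i, l⟩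
  · rfl
  · simp only [graphPoint]; exact (hx i l).symm

/-! ## Equation systems -/

/-- An EQUATION SYSTEM for `W_n`: a division-free arithmetic circuit over `ℂ[A,B,C]` (tree model
`ArithCircuit`, BCS Def. (4.2)) and a list of gate indices whose values are the test polynomials
(non-adaptive verification: accept iff all tests vanish). -/
structure EqSystem (n : ℕ) where
  /-- the straight-line program over `ℂ[A, B, C]` -/
  circuit : ArithCircuit ℂ (GraphVars n)
  /-- indices of the gates whose values are tested for `= 0` -/
  tests : List ℕ

namespace EqSystem

variable {n : ℕ}

/-- The value of gate `j` (junk `0` out of range — a vacuous test). -/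
def testPoly (E : EqSystem n) (j : ℕ) : MvPolynomial (GraphVars n) ℂ :=
  (gateValues E.circuit.gates).getD j 0

/-- The common zero set of the tests. -/
def zeroSet (E : EqSystem n) : Set (GraphVars n → ℂ) :=
  {x | ∀ j ∈ E.tests, MvPolynomial.eval x (E.testPoly j) = 0}

/-- CORRECT: fan-in two (so that size is the honest operation count) and the tests cut out exactly
the graph. -/
def Correct (E : EqSystem n) : Prop :=
  E.circuit.IsFanInTwo ∧ E.zeroSet = mmGraph n

/-- Cost = number of gates (BCS total count `L^tot` up to a factor `≤ 3`). -/
def cost (E : EqSystem n) : ℕ := E.circuit.size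

/-- Product gates only (Ostrowski's non-scalar count, up to the harmless over-count of products
with a constant operand). -/
def isProdGate {σ : Type} : Gate ℂ σ → Bool
  | .prod _ => true
  | .sum _ => false

/-- Number of product gates. -/
def prodCount (E : EqSystem n) : ℕ := (E.circuit.gates.filter isProdGate).length

/-- The Jacobian of the tests with respect to the `C`-variables, evaluated at `x`. -/
def jacobianC (E : EqSystem n) (x : GraphVars n → ℂ) :
    Matrix (Fin E.tests.length) (Fin n × Fin n) ℂ :=
  Matrix.of fun s q =>
    MvPolynomial.eval x (MvPolynomial.pderiv (Sum.inr q) (E.testPoly (E.tests.get s)))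

/-- REDUCED AT `x`: the `C`-Jacobian has full rank `n²` at `x` (the tests generate the ideal of the
graph locally at `x`, transversally to the fibre direction). -/
def ReducedAt (E : EqSystem n) (x : GraphVars n → ℂ) : Prop :=
  (E.jacobianC x).rank = n * n

/-- Reduced at SOME point of the graph (for a correct system this is reducedness on a Zariski-dense
open subset of the irreducible variety `W_n`; one point is what the truncation argument needs). -/
def GenericallyReduced (E : EqSystem n) : Prop :=
  ∃ x ∈ mmGraph n, E.ReducedAt x

/-- `prodCount ≤ cost`. -/
theorem prodCount_le_cost (E : EqSystem n) : E.prodCount ≤ E.cost :=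
  List.length_filter_le _ _

/-- Reduced at the origin ⇒ generically reduced (`0 ∈ W_n`). -/
theorem genericallyReduced_of_reducedAt_zero {E : EqSystem n} (h : E.ReducedAt 0) :
    E.GenericallyReduced :=
  ⟨0, zero_mem_mmGraph n, h⟩

/-- The tests of a correct system vanish on the graph. -/
theorem Correct.eval_testPoly_eq_zero {E : EqSystem n} (hE : E.Correct) {x : GraphVars n → ℂ}
    (hx : x ∈ mmGraph n) {j : ℕ} (hj : j ∈ E.tests) :
    MvPolynomial.eval x (E.testPoly j) = 0 := by
  have hx' : x ∈ E.zeroSet := by rw [hE.2]; exact hx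
  exact hx' j hj

/-- A correct system for `n ≥ 1` has at least one test (the empty conjunction accepts the point
`(0, 0, 𝟙)`, which is off the graph). -/
theorem Correct.tests_ne_nil {E : EqSystem n} (hE : E.Correct) (hn : 1 ≤ n) : E.tests ≠ [] := by
  intro hnil
  let x : GraphVars n → ℂ := fun v => Sum.elim (fun _ => 0) (fun _ => 1) v
  have hx : x ∈ E.zeroSet := by
    intro j hj; rw [hnil] at hj; simp at hj
  rw [hE.2] at hx
  have := hx ⟨0, hn⟩ ⟨0, hn⟩
  simp [x] at this

/-- The linear coefficient of a test in a `C`-variable is its `C`-partial derivative at the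
origin: `J_C(0)_{s,q} = coeff_{c_q}(t_s)`. -/
theorem jacobianC_zero_apply (E : EqSystem n) (s : Fin E.tests.length) (q : Fin n × Fin n) :
    E.jacobianC 0 s q =
      MvPolynomial.coeff (Finsupp.single (Sum.inr q : GraphVars n) 1) (E.testPoly (E.tests.get s)) := by
  simp only [jacobianC, Matrix.of_apply, MvPolynomial.eval_zero, MvPolynomial.constantCoeff_eq,
    MvPolynomial.coeff_pderiv, Finsupp.coe_zero, Pi.zero_apply, zero_add, Nat.cast_zero,
    mul_one]

end EqSystem

/-! ## Admissible verification exponents -/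

/-- `EqAdmissible β`: correct equation systems for `W_n` of cost `O(n^β)` exist (all `n ≥ 1`). -/
def EqAdmissible (β : ℝ) : Prop :=
  ∃ c : ℝ, ∀ n : ℕ, 1 ≤ n → ∃ E : EqSystem n, E.Correct ∧ (E.cost : ℝ) ≤ c * (n : ℝ) ^ β

/-- `EqAdmissibleRed β`: the same with GENERICALLY REDUCED systems. -/
def EqAdmissibleRed (β : ℝ) : Prop :=
  ∃ c : ℝ, ∀ n : ℕ, 1 ≤ n → ∃ E : EqSystem n, E.Correct ∧ E.GenericallyReduced ∧
    (E.cost : ℝ) ≤ c * (n : ℝ) ^ β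

/-- Reduced admissibility implies admissibility. -/
theorem EqAdmissibleRed.eqAdmissible {β : ℝ} (h : EqAdmissibleRed β) : EqAdmissible β := by
  obtain ⟨c, hc⟩ := h
  refine ⟨c, fun n hn => ?_⟩
  obtain ⟨E, hE, -, hcost⟩ := hc n hn
  exact ⟨E, hE, hcost⟩

/-- Monotonicity of `EqAdmissible` in the exponent. -/
theorem EqAdmissible.mono {β β' : ℝ} (h : EqAdmissible β) (hββ' : β ≤ β') :
    EqAdmissible β' := by
  obtain ⟨c, hc⟩ := h
  refine ⟨max c 0, fun n hn => ?_⟩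
  obtain ⟨E, hE, hcost⟩ := hc n hn
  refine ⟨E, hE, hcost.trans ?_⟩
  have hn1 : (1 : ℝ) ≤ n := by exact_mod_cast hn
  have h1 : (n : ℝ) ^ β ≤ (n : ℝ) ^ β' := Real.rpow_le_rpow_of_exponent_le hn1 hββ'
  have h0 : 0 ≤ (n : ℝ) ^ β := Real.rpow_nonneg (by positivity) _
  calc c * (n : ℝ) ^ β ≤ max c 0 * (n : ℝ) ^ β := mul_le_mul_of_nonneg_right (le_max_left c 0) h0
    _ ≤ max c 0 * (n : ℝ) ^ β' := mul_le_mul_of_nonneg_left h1 (le_max_right c 0)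

/-- Monotonicity of `EqAdmissibleRed` in the exponent. -/
theorem EqAdmissibleRed.mono {β β' : ℝ} (h : EqAdmissibleRed β) (hββ' : β ≤ β') :
    EqAdmissibleRed β' := by
  obtain ⟨c, hc⟩ := h
  refine ⟨max c 0, fun n hn => ?_⟩
  obtain ⟨E, hE, hred, hcost⟩ := hc n hn
  refine ⟨E, hE, hred, hcost.trans ?_⟩
  have hn1 : (1 : ℝ) ≤ n := by exact_mod_cast hn
  have h1 : (n : ℝ) ^ β ≤ (n : ℝ) ^ β' := Real.rpow_le_rpow_of_exponent_le hn1 hββ'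
  have h0 : 0 ≤ (n : ℝ) ^ β := Real.rpow_nonneg (by positivity) _
  calc c * (n : ℝ) ^ β ≤ max c 0 * (n : ℝ) ^ β := mul_le_mul_of_nonneg_right (le_max_left c 0) h0
    _ ≤ max c 0 * (n : ℝ) ^ β' := mul_le_mul_of_nonneg_left h1 (le_max_right c 0)

end Summit.MatrixMultiplication.MatrixMultiplication.Theorems.GraphEquations

end
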